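import Summits.ABC.ABC.Theorems.TwistAmplificationMazurKaneLawDetTool
import Summits.ABC.ABC.Theorems.TwistAmplificationMazurKaneLawToolkitTame
import Literature.NumberTheory.DiophantineGeometry.AbcShapeGeometrySets

/-!
# Off the wall the two tree tools give the shape law (crux stmt-ABC-2757, stub `stub_offWall`)

Stub 2 of the line `critical-kloosterman-powerful-moduli` for the crux
`Summit.ABC.ABC.Theses.TwistAmplification.MazurKaneLaw` (skeleton
`Summits/ABC/ABC/Cruxes/MazurKaneLaw/Lines/critical-kloosterman-powerful-moduli.lean`, `OffWallLaw`).
For data `(C₀; c₁, c₂, c₃; X, Y, Z)` admissible for `(l, ε)` (`AbcShapes.Admissible`), write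
`P = ∏ᵢ XᵢYᵢZᵢ`, `Pᵢ = XᵢYᵢZᵢ`, `R = C₀^{l−1+3ε}` (the law) and
`A = (c₁·shapeVal X)(c₂·shapeVal Y)(c₃·shapeVal Z)`. If `P ≤ 2R·P₀` (Kane's lattices in the linear
variables certify the law) or `P ≤ 2R·P₁ ∧ P³ ≤ 64R³·A` (the sharp conic with full modulus certifies it),
then `B_M ≤ K · C₀^{l−1+3ε+η}` for every `η > 0`, with `K` depending on `l, ε, η` and the dimension only.

Proof. In the exponent dictionary of the map line (`Toolkit.Certified`, scale `Λ = 2C₀`) the two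
hypotheses are exactly a subset-geometry certificate `I = J = K = {0}` resp. a determinant certificate at the
square coordinate `1`, both at the exponent `θ = (l − 1 + 3ε) + log_Λ 4` (`certified_of_offWall`:
`log_Λ(P/Pᵢ) ≤ log_Λ(2R) ≤ θ`, `log_Λ P − 1 ≤ l − 1 + 3ε`, and `log_Λ P − log_Λ A / 3 ≤ log_Λ(4R) ≤ θ`).
Then `shapeCount_le_of_certified` (with the landed determinant tool `detTool`) and the endgame constants of
`toolkitTame` (`T = V₂·2C₀`, `Dτ = ⌊C_τ T^κ⌋`, `P₀ = max(1, N₀, 2 log((M+2)T³)) ≪ Λ^{η/4}`) give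
`B ≤ Λ^θ · Dτ^{3M+3} · E · P₀ = 4 Λ^{l−1+3ε} · … ≤ K C₀^{l−1+3ε+η}` (`offWall_law`, any dimension `M`;
`stub_offWall` is the instance `M = numShapes ε`).
-/

noncomputable section

-- Summit.ABC.ABC is the mandated summit-side namespace (single-conjunct summit); the lakefile sets the same option tree-wide.
set_option linter.dupNamespace false

open Finset
open Literature.NumberTheory.DiophantineGeometry
open Literature.NumberTheory.DiophantineGeometry.AbcShapes
open Summit.ABC.ABC.Theorems.MazurKaneLaw.Toolkit

namespace Summit.ABC.ABC.Theorems.MazurKaneLaw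

/-- **The two off-wall hypotheses are toolkit certificates.** For positive data at scale `Λ = 2C₀`
(`C₀ ≥ 1`) with `P = ∏ XᵢYᵢZᵢ ≤ Λ^{x+1}`, `x > 0`, and coordinates `i₀ = 0`, `i₁ = 1`: if
`P ≤ 2C₀^x · P_{i₀}`, or `P ≤ 2C₀^x · P_{i₁}` and `P³ ≤ 64 (C₀^x)³ · A`
(`A = (c₁ shapeVal X)(c₂ shapeVal Y)(c₃ shapeVal Z)`), then the datum is `Certified Λ (x + log_Λ 4)`:
in the first case by the subset-geometry certificate `I = J = K = {i₀}` (`L − p₀ = log_Λ(P/P₀) ≤ log_Λ(2C₀^x)`,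
`L − 1 + 0 ≤ x`), in the second by the determinant certificate at `i₁`
(`L − p₁ ≤ log_Λ(2C₀^x)`, `L − 1 + e/3 = log_Λ P − log_Λ A/3 ≤ log_Λ(4C₀^x)`), using `log_Λ C₀ ≤ 1`. [folklore] -/
theorem certified_of_offWall {M : ℕ} {C₀ c₁ c₂ c₃ : ℕ} {X Y Z : Fin M → ℕ} (hC₀ : 1 ≤ C₀)
    (hc₁ : 0 < c₁) (hc₂ : 0 < c₂) (hc₃ : 0 < c₃) (hX : ∀ i, 0 < X i) (hY : ∀ i, 0 < Y i)
    (hZ : ∀ i, 0 < Z i) {x : ℝ} (hx : 0 < x)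
    (hP : (∏ i, ((X i : ℝ) * Y i * Z i)) ≤ (2 * C₀ : ℝ) ^ (x + 1)) {i₀ i₁ : Fin M}
    (hi₀ : (i₀ : ℕ) = 0) (hi₁ : (i₁ : ℕ) = 1)
    (h : (∏ i, ((X i : ℝ) * Y i * Z i)) ≤ 2 * (C₀ : ℝ) ^ x * ((X i₀ : ℝ) * Y i₀ * Z i₀) ∨
      ((∏ i, ((X i : ℝ) * Y i * Z i)) ≤ 2 * (C₀ : ℝ) ^ x * ((X i₁ : ℝ) * Y i₁ * Z i₁) ∧
        (∏ i, ((X i : ℝ) * Y i * Z i)) ^ 3 ≤ 64 * ((C₀ : ℝ) ^ x) ^ 3 *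
          (((c₁ * shapeVal X : ℕ) : ℝ) * ((c₂ * shapeVal Y : ℕ) : ℝ) * ((c₃ * shapeVal Z : ℕ) : ℝ)))) :
    Certified (2 * C₀) (x + Real.logb (2 * C₀) 4) c₁ c₂ c₃ X Y Z := by
  classical
  set Λ : ℝ := 2 * C₀ with hΛdef
  set P : ℝ := ∏ i, ((X i : ℝ) * Y i * Z i) with hPdef
  have hC₀r : (1 : ℝ) ≤ C₀ := by exact_mod_cast hC₀
  have hΛ : 1 < Λ := by rw [hΛdef]; linarith
  have hΛ0 : 0 < Λ := by linarith
  have hC₀Λ : (C₀ : ℝ) ≤ Λ := by rw [hΛdef]; linarith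
  have hpi : ∀ i, (0 : ℝ) < (X i : ℝ) * Y i * Z i := fun i => by
    have := hX i; have := hY i; have := hZ i; positivity
  have hP0 : 0 < P := prod_pos fun i _ => hpi i
  -- `log_Λ (XᵢYᵢZᵢ) = pᵢ` and `log_Λ P = L`
  have hlogp : ∀ i, Real.logb Λ ((X i : ℝ) * Y i * Z i) = expo Λ X i + expo Λ Y i + expo Λ Z i := by
    intro i
    have hx' : (0 : ℝ) < X i := by exact_mod_cast hX i
    have hy' : (0 : ℝ) < Y i := by exact_mod_cast hY i
    have hz' : (0 : ℝ) < Z i := by exact_mod_cast hZ i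
    rw [Real.logb_mul (by positivity) hz'.ne', Real.logb_mul hx'.ne' hy'.ne', expo, expo, expo]
  have hLP : Real.logb Λ P = radExp Λ X Y Z := by
    rw [radExp, hPdef, Real.logb_prod _ _ fun i _ => (hpi i).ne']
    exact sum_congr rfl fun i _ => hlogp i
  -- `0 ≤ log_Λ 2`, `log_Λ 4 = 2 log_Λ 2`, `log_Λ C₀^x ≤ x`, `log_Λ (2 C₀^x) ≤ θ`, `log_Λ P ≤ x + 1`
  have hl2 : 0 ≤ Real.logb Λ 2 := Real.logb_nonneg hΛ (by norm_num)
  have hl4 : Real.logb Λ 4 = 2 * Real.logb Λ 2 := by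
    rw [show (4 : ℝ) = 2 ^ 2 by norm_num, Real.logb_pow]; push_cast; ring
  have hR0 : 0 < (C₀ : ℝ) ^ x := by positivity
  have hlR : Real.logb Λ ((C₀ : ℝ) ^ x) ≤ x := by
    rw [Real.logb_rpow_eq_mul_logb_of_pos (by linarith)]
    have h1 : Real.logb Λ C₀ ≤ 1 := by
      rw [← Real.logb_self_eq_one hΛ]
      exact Real.logb_le_logb_of_le hΛ (by linarith) hC₀Λ
    nlinarith
  have h2R : Real.logb Λ (2 * (C₀ : ℝ) ^ x) ≤ x + Real.logb Λ 4 := by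
    rw [Real.logb_mul two_ne_zero hR0.ne']
    linarith
  have hLle : Real.logb Λ P ≤ x + 1 := by
    calc Real.logb Λ P ≤ Real.logb Λ (Λ ^ (x + 1)) := Real.logb_le_logb_of_le hΛ hP0 hP
      _ = x + 1 := Real.logb_rpow hΛ0 hΛ.ne'
  -- the "+1" branch of both certificates: `L - pᵢ ≤ log_Λ (2 C₀^x)` from `P ≤ 2 C₀^x · Pᵢ`
  have hfib : ∀ i, P ≤ 2 * (C₀ : ℝ) ^ x * ((X i : ℝ) * Y i * Z i) →
      radExp Λ X Y Z - (expo Λ X i + expo Λ Y i + expo Λ Z i) ≤ x + Real.logb Λ 4 := by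
    intro i hi
    have h1 : Real.logb Λ P ≤
        Real.logb Λ (2 * (C₀ : ℝ) ^ x) + Real.logb Λ ((X i : ℝ) * Y i * Z i) := by
      rw [← Real.logb_mul (by positivity) (hpi i).ne']
      exact Real.logb_le_logb_of_le hΛ hP0 hi
    rw [← hLP, ← hlogp i]
    linarith
  rcases h with h | ⟨h1, h2⟩
  · -- Kane's lattices: `GeometryCertifies` with `I = J = K = {i₀}`
    refine Or.inr (Or.inl ⟨{i₀}, {i₀}, {i₀}, ?_, ?_⟩)
    · simpa only [sum_singleton] using hfib i₀ h
    · have hi0 : ((i₀ : ℕ) : ℝ) = 0 := by exact_mod_cast hi₀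
      simp only [sum_singleton, hi0, zero_mul, add_zero]
      rw [← hLP]
      linarith
  · -- the sharp conic: `DeterminantCertifies` at `i₁`
    refine Or.inr (Or.inr (Or.inr ⟨i₁, by omega, hfib i₁ h1, ?_⟩))
    have hi1 : ((i₁ : ℕ) : ℝ) = 1 := by exact_mod_cast hi₁
    have hA1 : (0 : ℝ) < ((c₁ * shapeVal X : ℕ) : ℝ) := by exact_mod_cast Nat.mul_pos hc₁ (shapeVal_pos hX)
    have hA2 : (0 : ℝ) < ((c₂ * shapeVal Y : ℕ) : ℝ) := by exact_mod_cast Nat.mul_pos hc₂ (shapeVal_pos hY)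
    have hA3 : (0 : ℝ) < ((c₃ * shapeVal Z : ℕ) : ℝ) := by exact_mod_cast Nat.mul_pos hc₃ (shapeVal_pos hZ)
    have h64 : Real.logb Λ 64 = 3 * Real.logb Λ 4 := by
      rw [show (64 : ℝ) = 4 ^ 3 by norm_num, Real.logb_pow]; push_cast; ring
    have hrhs : Real.logb Λ (64 * ((C₀ : ℝ) ^ x) ^ 3 *
        (((c₁ * shapeVal X : ℕ) : ℝ) * ((c₂ * shapeVal Y : ℕ) : ℝ) * ((c₃ * shapeVal Z : ℕ) : ℝ))) =
        Real.logb Λ 64 + 3 * Real.logb Λ ((C₀ : ℝ) ^ x) +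
          (Real.logb Λ ((c₁ * shapeVal X : ℕ) : ℝ) + Real.logb Λ ((c₂ * shapeVal Y : ℕ) : ℝ) +
            Real.logb Λ ((c₃ * shapeVal Z : ℕ) : ℝ)) := by
      rw [Real.logb_mul (by positivity) (by positivity), Real.logb_mul (by norm_num) (by positivity),
        Real.logb_pow, Real.logb_mul (by positivity) hA3.ne', Real.logb_mul hA1.ne' hA2.ne']
      push_cast
      ring
    have h3 : 3 * Real.logb Λ P ≤ Real.logb Λ 64 + 3 * Real.logb Λ ((C₀ : ℝ) ^ x) +
        (Real.logb Λ ((c₁ * shapeVal X : ℕ) : ℝ) + Real.logb Λ ((c₂ * shapeVal Y : ℕ) : ℝ) +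
          Real.logb Λ ((c₃ * shapeVal Z : ℕ) : ℝ)) := by
      have h4 := Real.logb_le_logb_of_le hΛ (by positivity) h2
      rw [Real.logb_pow, hrhs, Nat.cast_ofNat] at h4
      linarith
    rw [hi1, sub_self, zero_mul, zero_add, deficiency, ← hLP]
    linarith

/-- **The off-wall law in every dimension `M`.** For `1 < l`, `0 < ε`, `0 < η` there is `K` such that every
datum `(C₀; c₁, c₂, c₃; X, Y, Z)` in dimension `M` admissible for `(l, ε)` and carrying one of the two off-wall
certificates (`P ≤ 2R·P_{i₀}`, or `P ≤ 2R·P_{i₁} ∧ P³ ≤ 64R³·A`, `R = C₀^{l−1+3ε}`, `i₀ = 0`, `i₁ = 1`) has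
`B_M ≤ K · C₀^{l−1+3ε+η}`. Proof: `certified_of_offWall` at `θ = l − 1 + 3ε + log_Λ 4`, `Λ = 2C₀`, then
`shapeCount_le_of_certified` with the determinant tool `detTool` and the endgame constants of `toolkitTame`
(`T = V₂·2C₀`, `Dτ = ⌊C_τ T^κ⌋`, `κ(3M+3) = η/4`, `P₀ = max(1, N₀, 2 log((M+2)T³)) ≤ P_c Λ^{η/4}`):
`B ≤ 4Λ^{l−1+3ε} Dτ^{3M+3} E P₀ ≤ K C₀^{l−1+3ε+η}`, `K = 4 · 2^{l−1+3ε+η/2} C_τ^{3M+3} V₂^{η/4} E P_c`. [folklore] -/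
theorem offWall_law (M : ℕ) {l ε η : ℝ} (hl : 1 < l) (hε : 0 < ε) (hη : 0 < η) :
    ∃ K : ℝ, ∀ (C₀ c₁ c₂ c₃ : ℕ) (X Y Z : Fin M → ℕ) (i₀ i₁ : Fin M), (i₀ : ℕ) = 0 → (i₁ : ℕ) = 1 →
      Admissible l ε C₀ c₁ c₂ c₃ X Y Z →
      ((∏ i, ((X i : ℝ) * Y i * Z i)) ≤ 2 * (C₀ : ℝ) ^ (l - 1 + 3 * ε) * ((X i₀ : ℝ) * Y i₀ * Z i₀) ∨
        ((∏ i, ((X i : ℝ) * Y i * Z i)) ≤ 2 * (C₀ : ℝ) ^ (l - 1 + 3 * ε) * ((X i₁ : ℝ) * Y i₁ * Z i₁) ∧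
          (∏ i, ((X i : ℝ) * Y i * Z i)) ^ 3 ≤ 64 * ((C₀ : ℝ) ^ (l - 1 + 3 * ε)) ^ 3 *
            (((c₁ * shapeVal X : ℕ) : ℝ) * ((c₂ * shapeVal Y : ℕ) : ℝ) * ((c₃ * shapeVal Z : ℕ) : ℝ)))) →
      (shapeCount c₁ c₂ c₃ X Y Z : ℝ) ≤ K * (C₀ : ℝ) ^ (l - 1 + 3 * ε + η) := by
  classical
  -- adapted from `toolkitTame` (Theorems/TwistAmplificationMazurKaneLawToolkitTame.lean): same constants
  obtain ⟨N₀, hN₀, hdet⟩ := detTool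
  -- the constants `V₂`, `a = 3M + 3`, `κ = η / (4a)`, `C_τ`, `κ₂ = η / 12`, `P_c`, `E`, `K`
  obtain ⟨V2, hV2⟩ : ∃ V : ℕ, V = shapeVal (fun _ : Fin M => 2) := ⟨_, rfl⟩
  have hV2pos : 0 < V2 := by rw [hV2]; exact shapeVal_pos fun _ => two_pos
  have hV2r : (0 : ℝ) < V2 := by exact_mod_cast hV2pos
  obtain ⟨a, ha⟩ : ∃ a : ℝ, a = 3 * (M : ℝ) + 3 := ⟨_, rfl⟩
  have ha0 : 0 < a := by rw [ha]; positivity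
  obtain ⟨κ, hκ⟩ : ∃ κ : ℝ, κ = η / 4 / a := ⟨_, rfl⟩
  have hκ0 : 0 < κ := by rw [hκ]; positivity
  have hκa : κ * a = η / 4 := by rw [hκ]; field_simp
  obtain ⟨Cτ, hCτ1, hCτ⟩ := Literature.NumberTheory.Sieve.exists_card_divisors_le_mul_rpow hκ0
  have hCτ0 : 0 < Cτ := by linarith
  obtain ⟨κ₂, hκ₂⟩ : ∃ κ₂ : ℝ, κ₂ = η / 12 := ⟨_, rfl⟩
  have hκ₂0 : 0 < κ₂ := by rw [hκ₂]; positivity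
  obtain ⟨G, hG⟩ : ∃ G : ℝ, G = ((M : ℝ) + 2) * (V2 : ℝ) ^ 3 := ⟨_, rfl⟩
  have hG0 : 0 < G := by rw [hG]; positivity
  obtain ⟨Pc, hPc⟩ : ∃ Pc : ℝ, Pc = 1 + N₀ + 2 * (G ^ κ₂ / κ₂) := ⟨_, rfl⟩
  have hPc1 : 1 + N₀ ≤ Pc := by rw [hPc]; linarith [show 0 ≤ 2 * (G ^ κ₂ / κ₂) by positivity]
  have hPc0 : 0 < Pc := by linarith
  obtain ⟨E, hE⟩ : ∃ E : ℝ, E = (2 : ℝ) ^ (2 * (M : ℝ) * M + 8) * (V2 : ℝ) * 27 * 48 *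
      (24 * (((M : ℝ) + 1) * ((M : ℝ) + 2))) := ⟨_, rfl⟩
  have hE0 : 0 < E := by rw [hE]; positivity
  obtain ⟨K, hK⟩ : ∃ K : ℝ,
      K = 4 * (2 : ℝ) ^ (l - 1 + 3 * ε + η / 2) * (Cτ ^ a * (V2 : ℝ) ^ (η / 4) * E * Pc) := ⟨_, rfl⟩
  have hK0 : 0 ≤ K := by rw [hK]; positivity
  refine ⟨K, fun C₀ c₁ c₂ c₃ X Y Z i₀ i₁ hi₀ hi₁ hA hoff => ?_⟩
  obtain ⟨hC₀1, hc₁, hc₂, hc₃, -, -, -, hXp, hYp, hZp, hPle, hvX, hvY, hvZ, hC₀le⟩ := hA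
  have hC₀ : (1 : ℝ) ≤ C₀ := by exact_mod_cast hC₀1
  rcases Nat.eq_zero_or_pos (shapeCount c₁ c₂ c₃ X Y Z) with hB0 | hBpos
  · rw [hB0, Nat.cast_zero]; positivity
  have hx0 : 0 < l - 1 + 3 * ε := by linarith
  -- `Λ = 2C₀` and the certificate at `θ = (l - 1 + 3ε) + log_Λ 4`
  obtain ⟨Λ, hΛdef⟩ : ∃ Λ : ℝ, Λ = 2 * C₀ := ⟨_, rfl⟩
  have hΛ : 1 < Λ := by rw [hΛdef]; linarith
  have hΛ0 : 0 < Λ := by linarith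
  have hcert : Certified Λ (l - 1 + 3 * ε + Real.logb Λ 4) c₁ c₂ c₃ X Y Z := by
    rw [hΛdef]
    exact certified_of_offWall hC₀1 hc₁ hc₂ hc₃ hXp hYp hZp hx0
      (by rw [show l - 1 + 3 * ε + 1 = l + 3 * ε by ring]; exact hPle) hi₀ hi₁ hoff
  -- `T = V₂ · 2C₀`, `Dτ = ⌊C_τ T^κ⌋`
  obtain ⟨T, hT⟩ : ∃ T : ℕ, T = V2 * (2 * C₀) := ⟨_, rfl⟩
  have hT1 : 1 ≤ T := by rw [hT]; exact Nat.mul_pos hV2pos (by omega)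
  have hT' : (T : ℝ) = V2 * Λ := by rw [hT, hΛdef]; push_cast; ring
  have hTval : ∀ {c : ℕ} {W : Fin M → ℕ}, c * shapeVal W ≤ 2 * C₀ →
      c * shapeVal (fun i => 2 * W i) ≤ T := by
    intro c W hW
    calc c * shapeVal (fun i => 2 * W i) = V2 * (c * shapeVal W) := by
          rw [show (fun i => 2 * W i) = fun i => (fun _ : Fin M => 2) i * W i from rfl,
            shapeVal_mul, ← hV2]; ring
      _ ≤ V2 * (2 * C₀) := Nat.mul_le_mul_left _ hW
      _ = T := hT.symm
  obtain ⟨Dτ, hDτ⟩ : ∃ D : ℕ, D = ⌊Cτ * (T : ℝ) ^ κ⌋₊ := ⟨_, rfl⟩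
  have hD : ∀ n : ℕ, n ≠ 0 → n ≤ T → n.divisors.card ≤ Dτ := by
    intro n hn hnT
    rw [hDτ]
    refine Nat.le_floor ((hCτ n hn).trans ?_)
    exact mul_le_mul_of_nonneg_left (Real.rpow_le_rpow (Nat.cast_nonneg _)
      (by exact_mod_cast hnT) hκ0.le) hCτ0.le
  have hDreal : (Dτ : ℝ) ≤ Cτ * (T : ℝ) ^ κ := by rw [hDτ]; exact Nat.floor_le (by positivity)
  -- `P₀ = max(1, N₀, 2 log((M+2) T³)) ≤ P_c Λ^{η/4}`
  obtain ⟨P₀, hP₀⟩ : ∃ P₀ : ℝ, P₀ = max 1 (max N₀ (2 * Real.log (((M : ℝ) + 2) * (T : ℝ) ^ 3))) := ⟨_, rfl⟩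
  have hP₀1 : 1 ≤ P₀ := by rw [hP₀]; exact le_max_left _ _
  have hN₀P₀ : N₀ ≤ P₀ := by rw [hP₀]; exact (le_max_left _ _).trans (le_max_right _ _)
  have hlogP₀ : 2 * Real.log (((M : ℝ) + 2) * (T : ℝ) ^ 3) ≤ P₀ := by
    rw [hP₀]; exact (le_max_right _ _).trans (le_max_right _ _)
  have hΛη : 1 ≤ Λ ^ (η / 4) := Real.one_le_rpow hΛ.le (by positivity)
  have hP₀le : P₀ ≤ Pc * Λ ^ (η / 4) := by
    have hPcΛ : Pc ≤ Pc * Λ ^ (η / 4) := le_mul_of_one_le_right hPc0.le hΛη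
    have h3 : Λ ^ (3 : ℝ) = Λ ^ (3 : ℕ) := by exact_mod_cast Real.rpow_natCast Λ 3
    have hx : ((M : ℝ) + 2) * (T : ℝ) ^ 3 = G * Λ ^ (3 : ℝ) := by rw [hG, hT', h3]; ring
    have hlog : Real.log (((M : ℝ) + 2) * (T : ℝ) ^ 3) ≤ (G ^ κ₂ / κ₂) * Λ ^ (η / 4) := by
      refine (Real.log_le_rpow_div (by positivity) hκ₂0).trans_eq ?_
      rw [hx, Real.mul_rpow hG0.le (by positivity), ← Real.rpow_mul hΛ0.le,
        show (3 : ℝ) * κ₂ = η / 4 by rw [hκ₂]; ring]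
      ring
    rw [hP₀]
    refine max_le (le_trans (by linarith) hPcΛ) (max_le (le_trans (by linarith) hPcΛ) ?_)
    calc 2 * Real.log (((M : ℝ) + 2) * (T : ℝ) ^ 3) ≤ 2 * (G ^ κ₂ / κ₂) * Λ ^ (η / 4) := by linarith
      _ ≤ Pc * Λ ^ (η / 4) := by
          refine mul_le_mul_of_nonneg_right ?_ (by positivity)
          rw [hPc]; linarith
  -- the determinant tool at every coordinate, for `P ≥ P₀`
  have hlogi : ∀ (i : Fin M) {P : ℝ}, P₀ ≤ P →
      2 * Real.log ((((i : ℕ) : ℝ) + 2) * (T : ℝ) ^ 3) ≤ P := by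
    intro i P hP
    have hi : (((i : ℕ) : ℝ) + 2) * (T : ℝ) ^ 3 ≤ ((M : ℝ) + 2) * (T : ℝ) ^ 3 := by
      have : ((i : ℕ) : ℝ) ≤ M := by exact_mod_cast i.isLt.le
      nlinarith [show (0 : ℝ) ≤ (T : ℝ) ^ 3 by positivity]
    have := Real.log_le_log (by positivity) hi
    linarith
  have hmul := shapeCount_le_of_certified hc₁ hc₂ hc₃ hXp hYp hZp (hTval hvX) (hTval hvY) (hTval hvZ)
    hD hΛ hBpos hC₀1 hΛdef hC₀le hP₀1
    (fun i hi P hP h48 => hdet hc₁ hc₂ hc₃ X Y Z hXp hYp hZp (hTval hvX) (hTval hvY) (hTval hvZ) hD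
      i hi P (hN₀P₀.trans hP) (hlogi i hP) h48) hcert
  rw [← hV2, ← ha, ← hE] at hmul
  -- `Dτ^a ≤ C_τ^a V₂^{η/4} Λ^{η/4}`
  have hD1 : 1 ≤ Dτ := by simpa using hD 1 one_ne_zero hT1
  have hDpos : (0 : ℝ) < Dτ := by exact_mod_cast hD1
  have hDa : (Dτ : ℝ) ^ a ≤ Cτ ^ a * (V2 : ℝ) ^ (η / 4) * Λ ^ (η / 4) := by
    calc (Dτ : ℝ) ^ a ≤ (Cτ * (T : ℝ) ^ κ) ^ a := Real.rpow_le_rpow (Nat.cast_nonneg _) hDreal ha0.le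
      _ = Cτ ^ a * (T : ℝ) ^ (η / 4) := by
          rw [Real.mul_rpow hCτ0.le (by positivity), ← Real.rpow_mul (Nat.cast_nonneg _), hκa]
      _ = Cτ ^ a * (V2 : ℝ) ^ (η / 4) * Λ ^ (η / 4) := by
          rw [hT', Real.mul_rpow hV2r.le hΛ0.le, mul_assoc]
  -- `Λ^θ Λ^{η/4} Λ^{η/4} = 4 · 2^{x+η/2} C₀^{x+η/2}` and `C₀^{x+η/2} ≤ C₀^{x+η}`
  have hΛθ : Λ ^ (l - 1 + 3 * ε + Real.logb Λ 4) = 4 * Λ ^ (l - 1 + 3 * ε) := by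
    rw [Real.rpow_add hΛ0, Real.rpow_logb hΛ0 hΛ.ne' (by norm_num)]; ring
  have e1 : Λ ^ (l - 1 + 3 * ε + η / 4 + η / 4) = Λ ^ (l - 1 + 3 * ε) * Λ ^ (η / 4) * Λ ^ (η / 4) := by
    rw [Real.rpow_add hΛ0, Real.rpow_add hΛ0]
  have hΛsplit : Λ ^ (l - 1 + 3 * ε + Real.logb Λ 4) * Λ ^ (η / 4) * Λ ^ (η / 4) =
      4 * ((2 : ℝ) ^ (l - 1 + 3 * ε + η / 2) * (C₀ : ℝ) ^ (l - 1 + 3 * ε + η / 2)) := by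
    rw [hΛθ, ← Real.mul_rpow zero_le_two (by linarith), ← hΛdef,
      show l - 1 + 3 * ε + η / 2 = l - 1 + 3 * ε + η / 4 + η / 4 by ring, e1]
    ring
  have hCη : (C₀ : ℝ) ^ (l - 1 + 3 * ε + η / 2) ≤ (C₀ : ℝ) ^ (l - 1 + 3 * ε + η) :=
    Real.rpow_le_rpow_of_exponent_le hC₀ (by linarith)
  have hθ0 : (0 : ℝ) ≤ Λ ^ (l - 1 + 3 * ε + Real.logb Λ 4) := by positivity
  calc (shapeCount c₁ c₂ c₃ X Y Z : ℝ)
      ≤ Λ ^ (l - 1 + 3 * ε + Real.logb Λ 4) * (Dτ : ℝ) ^ a * E * P₀ := hmul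
    _ ≤ Λ ^ (l - 1 + 3 * ε + Real.logb Λ 4) * (Cτ ^ a * (V2 : ℝ) ^ (η / 4) * Λ ^ (η / 4)) * E *
          (Pc * Λ ^ (η / 4)) :=
        mul_le_mul (mul_le_mul_of_nonneg_right (mul_le_mul_of_nonneg_left hDa hθ0) hE0.le) hP₀le
          (by linarith) (by positivity)
    _ = Cτ ^ a * (V2 : ℝ) ^ (η / 4) * E * Pc *
          (Λ ^ (l - 1 + 3 * ε + Real.logb Λ 4) * Λ ^ (η / 4) * Λ ^ (η / 4)) := by ring
    _ = K * (C₀ : ℝ) ^ (l - 1 + 3 * ε + η / 2) := by rw [hΛsplit, hK]; ring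
    _ ≤ K * (C₀ : ℝ) ^ (l - 1 + 3 * ε + η) := mul_le_mul_of_nonneg_left hCη hK0

/-- **STUB 2 · `stub_offWall` of the line `critical-kloosterman-powerful-moduli`** (crux stmt-ABC-2757,
`Summit.ABC.ABC.Theses.TwistAmplification.MazurKaneLaw`): OFF THE WALL THE TWO TREE TOOLS GIVE THE LAW. For
`1 < l < 2`, `0 < ε < 1/2`, `η > 0` there is `K` with `B_M ≤ K C₀^{l−1+3ε+η}` (`M = numShapes ε`) on every
admissible datum with `P ≤ 2R·P₀ ∨ (P ≤ 2R·P₁ ∧ P³ ≤ 64R³·A)`, `R = C₀^{l−1+3ε}`,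
`A = (c₁ shapeVal X)(c₂ shapeVal Y)(c₃ shapeVal Z)` — the instance `M = numShapes ε` of `offWall_law`
(Kane's lattices resp. the sharp conic, read as toolkit certificates at `l − 1 + 3ε + log_Λ 4` and closed by
`shapeCount_le_of_certified` + the landed determinant tool `detTool`). [folklore] -/
theorem stub_offWall : ∀ l : ℝ, 1 < l → l < 2 → ∀ ε : ℝ, 0 < ε → ε < 1 / 2 → ∀ η : ℝ, 0 < η → ∃ K : ℝ, ∀ (C₀ c₁ c₂ c₃ : ℕ) (X Y Z : Fin (Literature.NumberTheory.DiophantineGeometry.AbcShapes.numShapes ε) → ℕ) (i₀ i₁ : Fin (Literature.NumberTheory.DiophantineGeometry.AbcShapes.numShapes ε)), (i₀ : ℕ) = 0 → (i₁ : ℕ) = 1 → Literature.NumberTheory.DiophantineGeometry.AbcShapes.Admissible l ε C₀ c₁ c₂ c₃ X Y Z → ((∏ i, ((X i : ℝ) * Y i * Z i)) ≤ 2 * (C₀ : ℝ) ^ (l - 1 + 3 * ε) * ((X i₀ : ℝ) * Y i₀ * Z i₀) ∨ ((∏ i, ((X i : ℝ) * Y i * Z i)) ≤ 2 * (C₀ :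 ℝ) ^ (l - 1 + 3 * ε) * ((X i₁ : ℝ) * Y i₁ * Z i₁) ∧ (∏ i, ((X i : ℝ) * Y i * Z i)) ^ 3 ≤ 64 * ((C₀ : ℝ) ^ (l - 1 + 3 * ε)) ^ 3 * (((c₁ * Literature.NumberTheory.DiophantineGeometry.AbcShapes.shapeVal X : ℕ) : ℝ) * ((c₂ * Literature.NumberTheory.DiophantineGeometry.AbcShapes.shapeVal Y : ℕ) : ℝ) * ((c₃ * Literature.NumberTheory.DiophantineGeometry.AbcShapes.shapeVal Z : ℕ) : ℝ)))) → (Literature.NumberTheory.DiophantineGeometry.AbcShapes.shapeCount c₁ c₂ c₃ X Y Z : ℝ) ≤ K * (C₀ : ℝ) ^ (l - 1 + 3 * ε + η) :=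
  fun _l hl _ ε hε _ _η hη => offWall_law (numShapes ε) hl hε hη

end Summit.ABC.ABC.Theorems.MazurKaneLaw

end
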